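import Mathlib
import Summits.Ventures.HodgeRepro.Tier4.Target
import Summits.Ventures.HodgeRepro.Tier4.Common.TargetBall
import Summits.Ventures.HodgeRepro.Tier4.Common.TargetCalculus
import Summits.Ventures.HodgeRepro.Tier4.Common.TargetJacobian
import Summits.Ventures.HodgeRepro.Tier4.Common.AutForms
import Summits.Ventures.HodgeRepro.Tier4.LitCompactness
import Summits.Ventures.HodgeRepro.Tier4.Line3.KMDatumS
import Summits.Ventures.HodgeRepro.Tier4.Line3.Defs
import Summits.Ventures.HodgeRepro.Tier4.Line3.HeckeEquivarianceLemmas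
import Summits.Ventures.HodgeRepro.Tier4.Line3.LocaliserS
import Summits.Ventures.HodgeRepro.Tier4.Line3.BallChangeOfVariables
import Summits.Ventures.HodgeRepro.Tier4.Line3.DomainTransfer
import Summits.Ventures.HodgeRepro.Tier4.Line3.KernelIntegrable
import Summits.Ventures.HodgeRepro.Tier4.Line3.MajorantLemmas
import Summits.Ventures.HodgeRepro.Tier4.Line3.IntegrableMajorant
import Summits.Ventures.HodgeRepro.Tier4.Line3.ExpansionPointwise
import Summits.Ventures.HodgeRepro.Tier4.Line3.Expansion
import Summits.Ventures.HodgeRepro.Tier4.Line3.DecaySum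
import Summits.Ventures.HodgeRepro.Tier4.Line3.TermDominatedAssembly
import Summits.Ventures.HodgeRepro.Tier4.Line3.InvariantDensityTransfer
import Summits.Ventures.HodgeRepro.Tier4.Line3.OffMainInvariance
import Summits.Ventures.HodgeRepro.Tier4.Line3.GoodDomainCovering
import Summits.Ventures.HodgeRepro.Tier4.Line3.BoundaryDistance
import Summits.Ventures.HodgeRepro.Tier4.Line3.OffMainMassAssembly
import Summits.Ventures.HodgeRepro.Tier4.Line3.ClassBoundDef
import Summits.Ventures.HodgeRepro.Tier4.Line3.SupportMass

/-!
# Tier4/Line3/PointwiseOffMainBound — rung (A) of L3.5 from the class bound and the lattice Gaussian sum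

Blind re-derivation cell `pub-hodge-repro`, Tier 4 «PROVE THE STEP» (README §9–§10), LINE L3, seat t4-L2-p1 (on L3.5
with t4-L2-p3).  Rung (A) `PointwiseOffMainBound` of `Tier4/Line3/OffMainMassAssembly` — the off-main density at depth
`N` is `≤ K · e^{−κ q^{N/d}} / (1 − nsq z)^m` on the ball — COMPOSED from t4-L2-p3's class bound with the definite
Gaussians kept (`summand_bound_off_main_def`, ClassBoundDef: `‖summand (loc N) w z‖ ≤ B · majorantDefAt c₁ Φ e w z ·
C₁ e^{−κ q^{N/d}}` off the main orbit) and the LATTICE GAUSSIAN SUM (R2) in the form t4-x2 registered it (S12875):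
`Σ′_w suppMajorant D ℓ c₁ e N w z ≤ A / (1 − nsq z)^m` with `A, m` independent of `N` and `z` — taken here as the
DISPLAYED hypothesis `hR2` until x2's module lands.  Off the support the summand is `0` (`coefQ = 0`), so the class
bound holds with the support-restricted majorant for EVERY off-main tuple; the real exponent `m` of (R2) is replaced
by `⌈m⌉₊` (`(1 − nsq z)^{⌈m⌉₊} ≤ (1 − nsq z)^m` on the ball).  Mathlib-level on top of the two inputs.
Nothing here asserts anything about the truth of (P); HC_CM is NOT proved by anyone in this repository.
-/

set_option autoImplicit false

noncomputable section

namespace Summit.Ventures.HodgeRepro.Tier4.Line3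

open Summit.Ventures.HodgeRepro.Tier4
open Matrix MeasureTheory NumberField
open scoped ENNReal

namespace T4Data

variable (X : T4Data)

/-- Off the support of the localiser the summand vanishes. -/
theorem summand_eq_zero_of_not_mem_suppSet (D : X.ThetaData)
    {p : IsDedekindDomain.HeightOneSpectrum (RingOfIntegers X.E)}
    {L₀ : Submodule (RingOfIntegers X.E) (Fin 3 → X.E)} {xm : X.Tuple} (ℓ : X.LocS D p L₀ xm) (N : ℕ)
    {w : X.LineTuple} (hw : w ∉ X.suppSet D ℓ N) (z : Fin 2 → ℂ) : X.summand D.Φ D.cf (ℓ.loc N) w z = 0 := by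
  have h : X.coefQ D.cf (ℓ.loc N) (X.rep w) = 0 := by
    by_contra h
    exact hw h
  unfold summand
  rw [h, zero_mul]

/-- `0 ≤ nsq z`. -/
theorem nsq_nonneg' (z : Fin 2 → ℂ) : 0 ≤ nsq z := by
  unfold nsq
  positivity

/-- **RUNG (A) FROM THE CLASS BOUND AND THE LATTICE GAUSSIAN SUM**: if the support majorant with the definite Gaussians
sums to `≤ A / (1 − nsq z)^m` on the ball uniformly in the depth (x2's (R2), displayed), the off-main density is
`≤ (B C₁ A) · e^{−κ q^{N/d}} / (1 − nsq z)^{⌈m⌉₊}`. -/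
theorem pointwiseOffMainBound_of_suppMajorant_tsum_le (D : X.ThetaData)
    {p : IsDedekindDomain.HeightOneSpectrum (RingOfIntegers X.E)}
    {L₀ : Submodule (RingOfIntegers X.E) (Fin 3 → X.E)} {xm : X.Tuple}
    (h02 : xm 2 = xm 0) (h13 : xm 3 = xm 1) (hab : LinearIndependent X.E ![xm 0, xm 1]) (ℓ : X.LocS D p L₀ xm)
    (hR2 : ∀ c₁ e : ℝ, 0 < c₁ → ∃ A m : ℝ, 0 ≤ A ∧ 0 ≤ m ∧ ∀ (N : ℕ) (z : Fin 2 → ℂ), z ∈ ball →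
      Summable (fun w => X.suppMajorant D ℓ c₁ e N w z) ∧
        ∑' w, X.suppMajorant D ℓ c₁ e N w z ≤ A / (1 - nsq z) ^ m) :
    X.PointwiseOffMainBound D p L₀ xm ℓ := by
  obtain ⟨B, e, κ, C₁, c₁, hκ, hB, hC₁, hc₁, hcb⟩ := X.summand_bound_off_main_def D p L₀ xm h02 h13 hab ℓ
  obtain ⟨A, m, hA, hm, hR⟩ := hR2 c₁ e hc₁
  refine ⟨B * C₁ * A, κ, ⌈m⌉₊, hκ, by positivity, ?_⟩
  intro N z hz
  obtain ⟨hsum, hle⟩ := hR N z hz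
  have h1 : 0 < 1 - nsq z := sub_pos.mpr hz
  have h1' : 1 - nsq z ≤ 1 := by
    have := nsq_nonneg' z
    linarith
  have hdec : 0 ≤ X.offMainDecay p κ N := X.offMainDecay_nonneg p κ N
  have hpt : ∀ w : {w : X.LineTuple // X.orbitOf w ≠ X.orbitOf (X.lines xm)},
      ‖X.summand D.Φ D.cf (ℓ.loc N) w.1 z‖ₑ ≤
        ENNReal.ofReal (B * (C₁ * X.offMainDecay p κ N)) * ENNReal.ofReal (X.suppMajorant D ℓ c₁ e N w.1 z) := by
    intro w
    rw [← ENNReal.ofReal_mul (by positivity), ← ofReal_norm]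
    apply ENNReal.ofReal_le_ofReal
    by_cases hw : w.1 ∈ X.suppSet D ℓ N
    · rw [suppMajorant, Set.indicator_of_mem hw]
      have h := hcb N w.1 z hz w.2
      unfold offMainDecay
      calc ‖X.summand D.Φ D.cf (ℓ.loc N) w.1 z‖
          ≤ B * X.majorantDefAt c₁ D.Φ e w.1 z *
            (C₁ * Real.exp (-(κ * (((Ideal.absNorm p.asIdeal : ℝ) ^ N) ^ ((Module.finrank ℚ X.E : ℝ)⁻¹))))) := h
        _ = B * (C₁ * Real.exp (-(κ * (((Ideal.absNorm p.asIdeal : ℝ) ^ N) ^ ((Module.finrank ℚ X.E : ℝ)⁻¹))))) *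
            X.majorantDefAt c₁ D.Φ e w.1 z := by ring
    · rw [X.summand_eq_zero_of_not_mem_suppSet D ℓ N hw z, norm_zero]
      exact mul_nonneg (by positivity) (X.suppMajorant_nonneg D ℓ c₁ e N w.1 z)
  have hpow : A / (1 - nsq z) ^ m ≤ A / (1 - nsq z) ^ ⌈m⌉₊ := by
    apply div_le_div_of_nonneg_left hA (pow_pos h1 _)
    rw [← Real.rpow_natCast]
    exact Real.rpow_le_rpow_of_exponent_ge h1 h1' (Nat.le_ceil m)
  calc X.offMainDensity D (ℓ.loc N) xm z
      ≤ ∑' w : {w : X.LineTuple // X.orbitOf w ≠ X.orbitOf (X.lines xm)},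
          ENNReal.ofReal (B * (C₁ * X.offMainDecay p κ N)) * ENNReal.ofReal (X.suppMajorant D ℓ c₁ e N w.1 z) :=
        ENNReal.tsum_le_tsum hpt
    _ = ENNReal.ofReal (B * (C₁ * X.offMainDecay p κ N)) *
          ∑' w : {w : X.LineTuple // X.orbitOf w ≠ X.orbitOf (X.lines xm)},
            ENNReal.ofReal (X.suppMajorant D ℓ c₁ e N w.1 z) := ENNReal.tsum_mul_left
    _ ≤ ENNReal.ofReal (B * (C₁ * X.offMainDecay p κ N)) *
          ∑' w, ENNReal.ofReal (X.suppMajorant D ℓ c₁ e N w z) := by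
        gcongr
        refine (tsum_subtype {w : X.LineTuple | X.orbitOf w ≠ X.orbitOf (X.lines xm)}
          (fun w => ENNReal.ofReal (X.suppMajorant D ℓ c₁ e N w z))).trans_le ?_
        exact ENNReal.tsum_le_tsum fun w => Set.indicator_le_self _ _ w
    _ = ENNReal.ofReal (B * (C₁ * X.offMainDecay p κ N)) *
          ENNReal.ofReal (∑' w, X.suppMajorant D ℓ c₁ e N w z) := by
        rw [ENNReal.ofReal_tsum_of_nonneg (fun w => X.suppMajorant_nonneg D ℓ c₁ e N w z) hsum]
    _ ≤ ENNReal.ofReal (B * (C₁ * X.offMainDecay p κ N)) * ENNReal.ofReal (A / (1 - nsq z) ^ ⌈m⌉₊) := by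
        gcongr
        exact hle.trans hpow
    _ = ENNReal.ofReal (B * C₁ * A * X.offMainDecay p κ N / (1 - nsq z) ^ ⌈m⌉₊) := by
        rw [← ENNReal.ofReal_mul (by positivity)]
        congr 1
        ring


/-- **L3.5 ON THE NON-INVARIANT ROUTE, FOR THE RECORD**: the conclusion of `term_dominated` from the displayed lattice
Gaussian sum (R2), the bounded coset representatives (B) and the printed BHC row. -/
theorem term_dominated_of_suppMajorant_tsum_le (D : X.ThetaData)
    {p : IsDedekindDomain.HeightOneSpectrum (RingOfIntegers X.E)}
    {L₀ : Submodule (RingOfIntegers X.E) (Fin 3 → X.E)} {xm : X.Tuple}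
    (h02 : xm 2 = xm 0) (h13 : xm 3 = xm 1) (hab : LinearIndependent X.E ![xm 0, xm 1]) (ℓ : X.LocS D p L₀ xm)
    (hR2 : ∀ c₁ e : ℝ, 0 < c₁ → ∃ A m : ℝ, 0 ≤ A ∧ 0 ≤ m ∧ ∀ (N : ℕ) (z : Fin 2 → ℂ), z ∈ ball →
      Summable (fun w => X.suppMajorant D ℓ c₁ e N w z) ∧
        ∑' w, X.suppMajorant D ℓ c₁ e N w z ≤ A / (1 - nsq z) ^ m)
    {q₀ : ℕ} (hq₀ : 1 ≤ q₀) (hR : X.BoundedCosetReps D p L₀ xm ℓ q₀)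
    (hlit : Lit.BorelHarishChandra1962_Thm11_8_fundamentalDomain_hdef X.E X.H X.τ₀ X.C) :
    ∃ bound : X.Orbit → ℝ, (∀ o, 0 ≤ bound o) ∧ Summable bound ∧
      ∀ N (o : X.Orbit), o ≠ X.orbitOf (X.lines xm) → ‖X.term D.Φ D.cf (ℓ.level N) (ℓ.loc N) o‖ ≤ bound o :=
  X.term_dominated_of_bounds D ℓ hq₀ (X.pointwiseOffMainBound_of_suppMajorant_tsum_le D h02 h13 hab ℓ hR2) hR hlit

end T4Data

end Summit.Ventures.HodgeRepro.Tier4.Line3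

end
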